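import Summits.CriticalPhenomena.Ising3D.TaylorKernelPDExpansion
import Summits.CriticalPhenomena.Ising3D.TaylorOddConeKernel
import Mathlib.Tactic.Linarith
import Mathlib.Tactic.Positivity
import Mathlib.Tactic.Ring
import HarnessLib

/-!
# The symmetrised kernel: region and cone conditions need only its `D`-even part
(cell `pub-ising3x`, seat recog-1 gen 11; gate (g2): a strengthening of the kernel route for BOTH sectors)

HONEST FRAMING: lottery ticket; floor = tightest certified 3D Ising CFT bounds; no exact-solution
claim without a proof.

The antidiagonal weights `λ_{p₁}λ_{p₂}` are swap-invariant, so every weighted q-sum is the `λ`-average of the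
SYMMETRISED kernel `K_sym(u,v) = (K(u,v) + K(v,u))/2` (`qSum_eq_sum_evenKernelSymm`); in the variables
`(P, D) = (u+v-cc, u-v)` this is exactly the `D`-EVEN part of the generic expansion of `TaylorKernelPDExpansion`
(`evenKernelSymm_eq_sum_PD`). Consequently the kernel-route region theorems hold with the inequalities asked of
`K_sym` only, and only on the half-region `u ≤ v`: `taylorEvenRegion_half_of_symmKernelRegion(_le)` (even
sector; strengthens boot-1's `taylorEvenRegion_half_of_kernelRegion`) and `oddCone_half_of_symmKernelCone` (odd
cone; strengthens recog-1 g10's `oddCone_half_of_kernelCone`). Why it matters: a certificate's index set lists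
only `m ≥ n` (rc0 §1), so `K` itself is NOT symmetric and can fail pointwise (e.g. the single term `(a,b) = (1,0)`
gives `K ∝ u - s`, negative for small `u` however large `v`) where its average — all a q-sum sees — does not.
Elementary (finite sums). [folklore]
-/

namespace Summit.CriticalPhenomena.Ising3D

open Finset
open Literature.Analysis.ValidatedNumerics.PolyMP
open Literature.MathematicalPhysics.QuantumFieldTheory.ConformalBootstrap3D

/-! ### The symmetrised kernel: only the `D`-even part is constrained -/

/-- The symmetrised kernel `(K(u,v) + K(v,u))/2`. Since the antidiagonal weights `λ_{p₁}λ_{p₂}` are swap-invariant,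
every q-sum is also the `λ`-average of `K_sym` (`qSum_eq_sum_evenKernelSymm`); a region certificate may therefore
impose the kernel inequalities on `K_sym` — in the `(P, D)` variables the `D`-EVEN part of `K`
(`evenKernelSymm_eq_sum_PD`) — instead of on `K` itself (which, for an index set listing only `m ≥ n`, is not
symmetric and can fail pointwise where its average does not). [folklore] -/
noncomputable def evenKernelSymm (c : ℕ × ℕ → ℝ) (S : Finset (ℕ × ℕ)) (s σ u v : ℝ) : ℝ :=
  (evenKernel c S s σ u v + evenKernel c S s σ v u) / 2

/-- [folklore] -/
theorem evenKernelSymm_comm (c : ℕ × ℕ → ℝ) (S : Finset (ℕ × ℕ)) (s σ u v : ℝ) :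
    evenKernelSymm c S s σ u v = evenKernelSymm c S s σ v u := by
  unfold evenKernelSymm; ring

/-- **The q-sum is the `λ`-average of the SYMMETRISED kernel.** [folklore] -/
theorem qSum_eq_sum_evenKernelSymm (c : ℕ × ℕ → ℝ) (S : Finset (ℕ × ℕ)) (s σ E : ℝ) (j : ℕ) :
    qSum c S s σ E j = ∑ p ∈ antidiagonal j, legendreLam p.1 * legendreLam p.2 *
      evenKernelSymm c S s σ ((E - (j : ℝ)) / 2 + p.1) ((E - (j : ℝ)) / 2 + p.2) := by
  rw [qSum_eq_sum_evenKernel]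
  have key : ∑ p ∈ antidiagonal j, legendreLam p.1 * legendreLam p.2 *
      evenKernel c S s σ ((E - (j : ℝ)) / 2 + p.2) ((E - (j : ℝ)) / 2 + p.1) =
      ∑ p ∈ antidiagonal j, legendreLam p.1 * legendreLam p.2 *
        evenKernel c S s σ ((E - (j : ℝ)) / 2 + p.1) ((E - (j : ℝ)) / 2 + p.2) := by
    rw [← Nat.sum_antidiagonal_swap]
    simp only [Prod.fst_swap, Prod.snd_swap]
    exact Finset.sum_congr rfl fun p _ => by ring
  have h2 : ∑ p ∈ antidiagonal j, legendreLam p.1 * legendreLam p.2 *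
      evenKernelSymm c S s σ ((E - (j : ℝ)) / 2 + p.1) ((E - (j : ℝ)) / 2 + p.2) =
      (∑ p ∈ antidiagonal j, legendreLam p.1 * legendreLam p.2 *
          evenKernel c S s σ ((E - (j : ℝ)) / 2 + p.1) ((E - (j : ℝ)) / 2 + p.2) +
        ∑ p ∈ antidiagonal j, legendreLam p.1 * legendreLam p.2 *
          evenKernel c S s σ ((E - (j : ℝ)) / 2 + p.2) ((E - (j : ℝ)) / 2 + p.1)) / 2 := by
    unfold evenKernelSymm
    rw [← Finset.sum_add_distrib, Finset.sum_div]
    exact Finset.sum_congr rfl fun p _ => by ring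
  rw [h2, key]
  ring

/-- **In the `(P, D)` variables the symmetrised kernel is the `D`-even part**:
`K_sym(u,v) = Σ_{m,k<N} κ(m,2k) (u+v-cc)^m (u-v)^{2k}`. [folklore] -/
theorem evenKernelSymm_eq_sum_PD (c : ℕ × ℕ → ℝ) (S : Finset (ℕ × ℕ)) (s σ cc u v : ℝ) :
    evenKernelSymm c S s σ u v =
      ∑ mk ∈ range (kernelPDSize c S s σ cc) ×ˢ range (kernelPDSize c S s σ cc),
        kernelPDCoeff c S s σ cc mk.1 (2 * mk.2) * ((u + v - cc) ^ mk.1 * (u - v) ^ (2 * mk.2)) := by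
  unfold evenKernelSymm
  rw [evenKernel_eq_sum_PD c S s σ cc u v, evenKernel_eq_sum_PD c S s σ cc v u]
  have hP : v + u - cc = u + v - cc := by ring
  have hDe : ∀ k : ℕ, (v - u) ^ (2 * k) = (u - v) ^ (2 * k) := fun k => by
    rw [show v - u = -(u - v) by ring, Even.neg_pow ⟨k, by ring⟩]
  have hDo : ∀ k : ℕ, (v - u) ^ (2 * k + 1) = -(u - v) ^ (2 * k + 1) := fun k => by
    rw [show v - u = -(u - v) by ring, Odd.neg_pow ⟨k, rfl⟩]
  simp_rw [hP, hDe, hDo]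
  have hodd : ∑ mk ∈ range (kernelPDSize c S s σ cc) ×ˢ range (kernelPDSize c S s σ cc),
      kernelPDCoeff c S s σ cc mk.1 (2 * mk.2 + 1) * ((u + v - cc) ^ mk.1 * -(u - v) ^ (2 * mk.2 + 1)) =
      -∑ mk ∈ range (kernelPDSize c S s σ cc) ×ˢ range (kernelPDSize c S s σ cc),
        kernelPDCoeff c S s σ cc mk.1 (2 * mk.2 + 1) * ((u + v - cc) ^ mk.1 * (u - v) ^ (2 * mk.2 + 1)) := by
    rw [← Finset.sum_neg_distrib]
    exact Finset.sum_congr rfl fun mk _ => by ring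
  rw [hodd]
  ring

/-- The same over an index LIST (`S = l.toFinset`), with the table `coeff2 (kernelPDL c l s σ cc)`. [folklore] -/
theorem evenKernelSymm_eq_sum_PDL (c : ℕ × ℕ → ℝ) {l : List (ℕ × ℕ)} (hl : l.Nodup) (s σ cc u v : ℝ) :
    evenKernelSymm c l.toFinset s σ u v =
      ∑ mk ∈ range (size2 (kernelPDL c l s σ cc)) ×ˢ range (size2 (kernelPDL c l s σ cc)),
        coeff2 (kernelPDL c l s σ cc) mk.1 (2 * mk.2) * ((u + v - cc) ^ mk.1 * (u - v) ^ (2 * mk.2)) := by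
  unfold evenKernelSymm
  rw [evenKernel_eq_sum_PDL c hl s σ cc u v, evenKernel_eq_sum_PDL c hl s σ cc v u]
  have hP : v + u - cc = u + v - cc := by ring
  have hDe : ∀ k : ℕ, (v - u) ^ (2 * k) = (u - v) ^ (2 * k) := fun k => by
    rw [show v - u = -(u - v) by ring, Even.neg_pow ⟨k, by ring⟩]
  have hDo : ∀ k : ℕ, (v - u) ^ (2 * k + 1) = -(u - v) ^ (2 * k + 1) := fun k => by
    rw [show v - u = -(u - v) by ring, Odd.neg_pow ⟨k, rfl⟩]
  simp_rw [hP, hDe, hDo]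
  have hodd : ∑ mk ∈ range (size2 (kernelPDL c l s σ cc)) ×ˢ range (size2 (kernelPDL c l s σ cc)),
      coeff2 (kernelPDL c l s σ cc) mk.1 (2 * mk.2 + 1) * ((u + v - cc) ^ mk.1 * -(u - v) ^ (2 * mk.2 + 1)) =
      -∑ mk ∈ range (size2 (kernelPDL c l s σ cc)) ×ˢ range (size2 (kernelPDL c l s σ cc)),
        coeff2 (kernelPDL c l s σ cc) mk.1 (2 * mk.2 + 1) * ((u + v - cc) ^ mk.1 * (u - v) ^ (2 * mk.2 + 1)) := by
    rw [← Finset.sum_neg_distrib]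
    exact Finset.sum_congr rfl fun mk _ => by ring
  rw [hodd]
  ring

/-- **Row form of the symmetrised kernel**: `K_sym(u,v) = Σ_{k<N} (row_{2k})(P) · (D²)^k`, `P = u+v-cc`, `D = u-v`,
for any `N ≥ size2` of the table (rows read through `getD`, evaluated by `evalR`). [folklore] -/
theorem evenKernelSymm_eq_sum_rows (c : ℕ × ℕ → ℝ) {l : List (ℕ × ℕ)} (hl : l.Nodup) (s σ cc : ℝ) {N : ℕ}
    (hN : size2 (kernelPDL c l s σ cc) ≤ N) (u v : ℝ) :
    evenKernelSymm c l.toFinset s σ u v =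
      ∑ k ∈ range N, evalR ((kernelPDL c l s σ cc).getD (2 * k) []) (u + v - cc) * ((u - v) ^ 2) ^ k := by
  rw [evenKernelSymm_eq_sum_PDL c hl s σ cc u v, Finset.sum_product_right]
  -- pad the square `size2 × size2` to `N × N` (entries vanish outside), then read rows through `evalR`
  set Q := kernelPDL c l s σ cc with hQ
  have hrow : ∀ k : ℕ, ∑ m ∈ range (size2 Q), coeff2 Q m (2 * k) * ((u + v - cc) ^ m * (u - v) ^ (2 * k)) =
      evalR (Q.getD (2 * k) []) (u + v - cc) * ((u - v) ^ 2) ^ k := by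
    intro k
    rw [evalR_eq_sum_pad (Q.getD (2 * k) []) (length_getD_le_size2 Q (2 * k)), Finset.sum_mul]
    refine Finset.sum_congr rfl fun m _ => ?_
    rw [coeff2, ← pow_mul]
    ring
  simp_rw [hrow]
  -- rows `k ≥ size2` are empty
  refine Finset.sum_subset (range_subset_range.2 hN) fun k hk hk' => ?_
  have hk2 : size2 Q ≤ 2 * k := by simp only [mem_range, not_lt] at hk hk'; omega
  rw [List.getD_eq_default _ _ ((length_le_size2 Q).trans hk2), evalR_nil, zero_mul]

/-- **The even region from the SYMMETRISED kernel condition** (strengthens `taylorEvenRegion_half_of_kernelRegion`: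
the three inequalities are asked of `K_sym` only). [cite: KosPolandSimmonsduffin2014, §3.3 eq. (3.16)] -/
theorem taylorEvenRegion_half_of_symmKernelRegion (S : Finset (ℕ × ℕ)) (w : Fin 5 → ℕ × ℕ → ℝ)
    (Q : Set (ℝ × ℝ)) (E₀ : ℝ)
    (hK : ∀ p ∈ Q, ∀ u v : ℝ, 0 ≤ u → 0 ≤ v → E₀ ≤ u + v →
      0 ≤ evenKernelSymm (w 0) S p.1 (-1) u v ∧ 0 ≤ evenKernelSymm (w 1) S p.2 (-1) u v ∧
        (evenKernelSymm (w 3) S ((p.1 + p.2) / 2) (-1) u v + evenKernelSymm (w 4) S ((p.1 + p.2) / 2) 1 u v) ^ 2 ≤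
          4 * evenKernelSymm (w 0) S p.1 (-1) u v * evenKernelSymm (w 1) S p.2 (-1) u v) :
    TaylorEvenRegion (taylorCrossing (1 / 2) (1 / 2) S w) Q E₀ := by
  refine taylorEvenRegion_half_of_qRegion S w Q E₀ fun p hp E j hE hj => ?_
  rw [qSum_eq_sum_evenKernelSymm, qSum_eq_sum_evenKernelSymm, qSum_eq_sum_evenKernelSymm,
    qSum_eq_sum_evenKernelSymm, ← Finset.sum_add_distrib]
  have hz : ∀ q ∈ antidiagonal j,
      legendreLam q.1 * legendreLam q.2 * evenKernelSymm (w 3) S ((p.1 + p.2) / 2) (-1)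
          ((E - (j : ℝ)) / 2 + q.1) ((E - (j : ℝ)) / 2 + q.2) +
        legendreLam q.1 * legendreLam q.2 * evenKernelSymm (w 4) S ((p.1 + p.2) / 2) 1
          ((E - (j : ℝ)) / 2 + q.1) ((E - (j : ℝ)) / 2 + q.2) =
      legendreLam q.1 * legendreLam q.2 * (evenKernelSymm (w 3) S ((p.1 + p.2) / 2) (-1)
          ((E - (j : ℝ)) / 2 + q.1) ((E - (j : ℝ)) / 2 + q.2) + evenKernelSymm (w 4) S ((p.1 + p.2) / 2) 1
          ((E - (j : ℝ)) / 2 + q.1) ((E - (j : ℝ)) / 2 + q.2)) := fun q _ => by ring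
  rw [Finset.sum_congr rfl hz]
  have hpt : ∀ q ∈ antidiagonal j, 0 ≤ (E - (j : ℝ)) / 2 + q.1 ∧ 0 ≤ (E - (j : ℝ)) / 2 + q.2 ∧
      E₀ ≤ (E - (j : ℝ)) / 2 + q.1 + ((E - (j : ℝ)) / 2 + q.2) := by
    intro q hq
    have hq' : (q.1 : ℝ) + q.2 = j := by exact_mod_cast mem_antidiagonal.mp hq
    have h1 : (0 : ℝ) ≤ (E - (j : ℝ)) / 2 := by linarith
    exact ⟨add_nonneg h1 (Nat.cast_nonneg _), add_nonneg h1 (Nat.cast_nonneg _), by linarith⟩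
  exact det_of_sum_psd (antidiagonal j) (fun q => legendreLam q.1 * legendreLam q.2) _ _ _
    (fun q _ => mul_nonneg (legendreLam_pos _).le (legendreLam_pos _).le)
    (fun q hq => (hK p hp _ _ (hpt q hq).1 (hpt q hq).2.1 (hpt q hq).2.2).1)
    (fun q hq => (hK p hp _ _ (hpt q hq).1 (hpt q hq).2.1 (hpt q hq).2.2).2.1)
    (fun q hq => (hK p hp _ _ (hpt q hq).1 (hpt q hq).2.1 (hpt q hq).2.2).2.2)

/-- The same with the hypothesis asked only on the half-region `u ≤ v` (`K_sym` is symmetric). [folklore] -/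
theorem taylorEvenRegion_half_of_symmKernelRegion_le (S : Finset (ℕ × ℕ)) (w : Fin 5 → ℕ × ℕ → ℝ)
    (Q : Set (ℝ × ℝ)) (E₀ : ℝ)
    (hK : ∀ p ∈ Q, ∀ u v : ℝ, 0 ≤ u → u ≤ v → E₀ ≤ u + v →
      0 ≤ evenKernelSymm (w 0) S p.1 (-1) u v ∧ 0 ≤ evenKernelSymm (w 1) S p.2 (-1) u v ∧
        (evenKernelSymm (w 3) S ((p.1 + p.2) / 2) (-1) u v + evenKernelSymm (w 4) S ((p.1 + p.2) / 2) 1 u v) ^ 2 ≤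
          4 * evenKernelSymm (w 0) S p.1 (-1) u v * evenKernelSymm (w 1) S p.2 (-1) u v) :
    TaylorEvenRegion (taylorCrossing (1 / 2) (1 / 2) S w) Q E₀ := by
  refine taylorEvenRegion_half_of_symmKernelRegion S w Q E₀ fun p hp u v hu hv hE => ?_
  rcases le_total u v with huv | hvu
  · exact hK p hp u v hu huv hE
  · have h := hK p hp v u hv hvu (by linarith)
    rw [evenKernelSymm_comm (w 0), evenKernelSymm_comm (w 1), evenKernelSymm_comm (w 3),
      evenKernelSymm_comm (w 4)] at h
    exact h

/-- **The odd cone from the SYMMETRISED kernel condition** (strengthens `oddCone_half_of_kernelCone`: (KM)/(KR)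
are asked of the five `K_sym`'s only). [cite: KosPolandSimmonsduffin2014, §3.3 eq. (3.16)] -/
theorem oddCone_half_of_symmKernelCone (S : Finset (ℕ × ℕ)) (w : Fin 5 → ℕ × ℕ → ℝ)
    (Sψ : Finset (ℕ × ℕ)) (ψ : ℕ × ℕ → ℝ) {κ₀ : ℝ} (hκ₀ : 0 ≤ κ₀) (Δσ Δε E_T : ℝ)
    (hK : ∀ u v : ℝ, 0 ≤ u → 0 ≤ v → E_T ≤ u + v →
      (1 / 2 : ℝ) ^ (Δσ + Δε) * |evenKernelSymm (w 2) S ((Δσ + Δε) / 2) (-1) u v| ≤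
          evenKernelSymm ψ Sψ 0 0 u v ∧
        κ₀ / 2 * ((1 / 2 : ℝ) ^ (Δε - Δσ) * |evenKernelSymm (w 2) S ((Δσ + Δε) / 2) (-1) u v|) +
            κ₀⁻¹ / 2 * ((1 / 2 : ℝ) ^ (-(2 * Δε)) * evenKernelSymm ψ Sψ (Δσ - Δε) 0 u v) ≤
          evenKernelSymm (w 3) S Δσ (-1) u v - evenKernelSymm (w 4) S Δσ 1 u v) :
    ∀ (E : ℝ) (j : ℕ), E_T ≤ E → (j : ℝ) ≤ E →
      OddConeAt (taylorCrossing (1 / 2) (1 / 2) S w)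
        (∑ ab ∈ Sψ, ψ ab • taylorCoeffAt (1 / 2) (1 / 2) ab) κ₀ Δσ Δε E j := by
  intro E j hE hj
  have h0 : (0 : ℝ) < 1 / 2 := by norm_num
  have hκ₁ : 0 ≤ (1 / 2 : ℝ) ^ (Δσ + Δε) := (Real.rpow_pos_of_pos h0 _).le
  have hκ₂ : 0 ≤ (1 / 2 : ℝ) ^ (Δε - Δσ) := (Real.rpow_pos_of_pos h0 _).le
  have hlam0 : ∀ q : ℕ × ℕ, 0 ≤ legendreLam q.1 * legendreLam q.2 :=
    fun q => mul_nonneg (legendreLam_pos _).le (legendreLam_pos _).le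
  have hKq : ∀ q ∈ antidiagonal j,
      (1 / 2 : ℝ) ^ (Δσ + Δε) *
            |evenKernelSymm (w 2) S ((Δσ + Δε) / 2) (-1) ((E - (j : ℝ)) / 2 + q.1) ((E - (j : ℝ)) / 2 + q.2)| ≤
          evenKernelSymm ψ Sψ 0 0 ((E - (j : ℝ)) / 2 + q.1) ((E - (j : ℝ)) / 2 + q.2) ∧
        κ₀ / 2 * ((1 / 2 : ℝ) ^ (Δε - Δσ) *
              |evenKernelSymm (w 2) S ((Δσ + Δε) / 2) (-1) ((E - (j : ℝ)) / 2 + q.1) ((E - (j : ℝ)) / 2 + q.2)|) +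
            κ₀⁻¹ / 2 * ((1 / 2 : ℝ) ^ (-(2 * Δε)) *
              evenKernelSymm ψ Sψ (Δσ - Δε) 0 ((E - (j : ℝ)) / 2 + q.1) ((E - (j : ℝ)) / 2 + q.2)) ≤
          evenKernelSymm (w 3) S Δσ (-1) ((E - (j : ℝ)) / 2 + q.1) ((E - (j : ℝ)) / 2 + q.2) -
            evenKernelSymm (w 4) S Δσ 1 ((E - (j : ℝ)) / 2 + q.1) ((E - (j : ℝ)) / 2 + q.2) := by
    intro q hq
    have hq' : (q.1 : ℝ) + q.2 = j := by exact_mod_cast mem_antidiagonal.mp hq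
    have h1 : (0 : ℝ) ≤ (E - (j : ℝ)) / 2 := by linarith
    exact hK _ _ (add_nonneg h1 (Nat.cast_nonneg _)) (add_nonneg h1 (Nat.cast_nonneg _)) (by linarith)
  have habs : |qSum (w 2) S ((Δσ + Δε) / 2) (-1) E j| ≤
      ∑ q ∈ antidiagonal j, legendreLam q.1 * legendreLam q.2 *
        |evenKernelSymm (w 2) S ((Δσ + Δε) / 2) (-1) ((E - (j : ℝ)) / 2 + q.1) ((E - (j : ℝ)) / 2 + q.2)| := by
    rw [qSum_eq_sum_evenKernelSymm]
    exact abs_sum_antidiagonal_lam_le j _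
  refine oddConeAt_half_of_qCone S w Sψ ψ κ₀ Δσ Δε E j hj ?_ ?_
  · calc (1 / 2 : ℝ) ^ (Δσ + Δε) * |qSum (w 2) S ((Δσ + Δε) / 2) (-1) E j|
        ≤ (1 / 2 : ℝ) ^ (Δσ + Δε) * ∑ q ∈ antidiagonal j, legendreLam q.1 * legendreLam q.2 *
            |evenKernelSymm (w 2) S ((Δσ + Δε) / 2) (-1) ((E - (j : ℝ)) / 2 + q.1) ((E - (j : ℝ)) / 2 + q.2)| :=
          mul_le_mul_of_nonneg_left habs hκ₁
      _ = ∑ q ∈ antidiagonal j, legendreLam q.1 * legendreLam q.2 * ((1 / 2 : ℝ) ^ (Δσ + Δε) *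
            |evenKernelSymm (w 2) S ((Δσ + Δε) / 2) (-1) ((E - (j : ℝ)) / 2 + q.1) ((E - (j : ℝ)) / 2 + q.2)|) := by
          rw [Finset.mul_sum]
          exact Finset.sum_congr rfl fun q _ => by ring
      _ ≤ ∑ q ∈ antidiagonal j, legendreLam q.1 * legendreLam q.2 *
            evenKernelSymm ψ Sψ 0 0 ((E - (j : ℝ)) / 2 + q.1) ((E - (j : ℝ)) / 2 + q.2) :=
          Finset.sum_le_sum fun q hq => mul_le_mul_of_nonneg_left (hKq q hq).1 (hlam0 q)
      _ = qSum ψ Sψ 0 0 E j := by rw [qSum_eq_sum_evenKernelSymm]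
  · have h1 : κ₀ / 2 * ((1 / 2 : ℝ) ^ (Δε - Δσ) * |qSum (w 2) S ((Δσ + Δε) / 2) (-1) E j|) ≤
        κ₀ / 2 * ((1 / 2 : ℝ) ^ (Δε - Δσ) * ∑ q ∈ antidiagonal j, legendreLam q.1 * legendreLam q.2 *
          |evenKernelSymm (w 2) S ((Δσ + Δε) / 2) (-1) ((E - (j : ℝ)) / 2 + q.1) ((E - (j : ℝ)) / 2 + q.2)|) :=
      mul_le_mul_of_nonneg_left (mul_le_mul_of_nonneg_left habs hκ₂) (by positivity)
    have h2 : κ₀ / 2 * ((1 / 2 : ℝ) ^ (Δε - Δσ) * ∑ q ∈ antidiagonal j, legendreLam q.1 * legendreLam q.2 *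
            |evenKernelSymm (w 2) S ((Δσ + Δε) / 2) (-1) ((E - (j : ℝ)) / 2 + q.1) ((E - (j : ℝ)) / 2 + q.2)|) +
          κ₀⁻¹ / 2 * ((1 / 2 : ℝ) ^ (-(2 * Δε)) * qSum ψ Sψ (Δσ - Δε) 0 E j) =
        ∑ q ∈ antidiagonal j, legendreLam q.1 * legendreLam q.2 *
          (κ₀ / 2 * ((1 / 2 : ℝ) ^ (Δε - Δσ) *
              |evenKernelSymm (w 2) S ((Δσ + Δε) / 2) (-1) ((E - (j : ℝ)) / 2 + q.1) ((E - (j : ℝ)) / 2 + q.2)|) +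
            κ₀⁻¹ / 2 * ((1 / 2 : ℝ) ^ (-(2 * Δε)) *
              evenKernelSymm ψ Sψ (Δσ - Δε) 0 ((E - (j : ℝ)) / 2 + q.1) ((E - (j : ℝ)) / 2 + q.2))) := by
      rw [qSum_eq_sum_evenKernelSymm]
      simp only [Finset.mul_sum]
      rw [← Finset.sum_add_distrib]
      exact Finset.sum_congr rfl fun q _ => by ring
    have h3 : ∑ q ∈ antidiagonal j, legendreLam q.1 * legendreLam q.2 *
          (κ₀ / 2 * ((1 / 2 : ℝ) ^ (Δε - Δσ) *
              |evenKernelSymm (w 2) S ((Δσ + Δε) / 2) (-1) ((E - (j : ℝ)) / 2 + q.1) ((E - (j : ℝ)) / 2 + q.2)|) +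
            κ₀⁻¹ / 2 * ((1 / 2 : ℝ) ^ (-(2 * Δε)) *
              evenKernelSymm ψ Sψ (Δσ - Δε) 0 ((E - (j : ℝ)) / 2 + q.1) ((E - (j : ℝ)) / 2 + q.2))) ≤
        ∑ q ∈ antidiagonal j, legendreLam q.1 * legendreLam q.2 *
          (evenKernelSymm (w 3) S Δσ (-1) ((E - (j : ℝ)) / 2 + q.1) ((E - (j : ℝ)) / 2 + q.2) -
            evenKernelSymm (w 4) S Δσ 1 ((E - (j : ℝ)) / 2 + q.1) ((E - (j : ℝ)) / 2 + q.2)) :=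
      Finset.sum_le_sum fun q hq => mul_le_mul_of_nonneg_left (hKq q hq).2 (hlam0 q)
    have h4 : ∑ q ∈ antidiagonal j, legendreLam q.1 * legendreLam q.2 *
          (evenKernelSymm (w 3) S Δσ (-1) ((E - (j : ℝ)) / 2 + q.1) ((E - (j : ℝ)) / 2 + q.2) -
            evenKernelSymm (w 4) S Δσ 1 ((E - (j : ℝ)) / 2 + q.1) ((E - (j : ℝ)) / 2 + q.2)) =
        qSum (w 3) S Δσ (-1) E j - qSum (w 4) S Δσ 1 E j := by
      rw [qSum_eq_sum_evenKernelSymm, qSum_eq_sum_evenKernelSymm, ← Finset.sum_sub_distrib]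
      exact Finset.sum_congr rfl fun q _ => by ring
    linarith [h1, h2, h3, h4]

end Summit.CriticalPhenomena.Ising3D
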